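import Summits.AnomalousDissipation.AnomalousDissipation.Theorems.SolenoidalFractalHomogenisationLagrangianStepSidebandXRhoBound
import HarnessLib

/-!
# K1L_D `LagrangianRenormalisationStepDesign` (stmt-AnomalousDissipation-27980), `stub_D1_V0R` (ruling D27-1), brick T8d-(e), part 2b: SCALAR
# REPACKAGING of the master rate function into the clause bound — every error term is `O(ν + ξ')·min(1, r̄t)` or `O(r̄·P₁)` with
# `ν`-INDEPENDENT constants, `σ = 1` (helper; `--kind proof --supports stmt-AnomalousDissipation-27980 --as helper`)

Summits-side helper file of route `SolenoidalFractalHomogenisation` (prover seat `ad-k1l-cellLawV-w1` g8; 0 sorry, no defs, no named facts; pure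
real arithmetic on ABSTRACT ATOMS, instantiated by the assembly of `stub_D1_V0R`).  Atoms as in `…SidebandXRhoBound`, plus `P₁ = W₁.period = P₀/ν`,
`Gn` (the norm of the effective generator), `r_lo` (its coercivity rate, `≥ 4π²cψξ²/ν`, `≤ q·r̄`), `r̄` (the clause rate, `≥ 8π²Hξ²/ν`, `H = hiΛc`),
`S = √ρ₂ ≤ s(ν+ξ')ξ/ν`, `M` (the a priori bound of the slow mode).
* `termA_le`, `termB1_le`, `termB2_le`, `bpre_le`, **`master_le_half_clause`** — the right-hand side of the master estimate
  (`…SidebandXSlowAveragingWeighted.norm_modeRep_sub_exp_le_weighted` fed with `…SidebandXResidualBound.forcing_integral_le_single`) is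
  `≤ M·(C(C(ν + ξ')min(1, r̄t) + r̄P₁))/2` for every `C ≥ 1` above two explicit `ν`-free thresholds;
* `two_mul_sq_le_of_le_half` — `X ≤ √E₀·B/2 ⇒ 2X² ≤ B²E₀` (the clause's currency);
* `hsmall_of_window`, `xi_le_nu_mul_xi'`, `K_mul_xi_le_nu`, `two_mul_lt_of_res`, `n_ne_zero_of_res` — the arithmetic of the clause's resolution
  hypothesis `|ℓ|·⌈K/ν⌉₊ ≤ n` (`ξ ≤ νξ'`, `Kξ ≤ ν`, `2|ℓ| < n`, `n ≠ 0`) and the smallness input of the residual sup bound.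
NOT a proof of any registered stub, of K1L_D, or of anomalous dissipation; rung F-D1.A0 infrastructure.
-/

set_option linter.dupNamespace false

noncomputable section

namespace Summit.AnomalousDissipation.AnomalousDissipation.Theorems.SolenoidalFractalHomogenisation.LagrangianStep.Sideband

/-! ## The master rate function is at most half the clause bound -/

/-- Term A (the averaging defect of the slow mode): `M·L·P₁·(1 + (2Gn+L)/r_lo) ≤ M·κ_A·(r̄·P₁)`, `κ_A = C_f A_N (5 + a₁)/(4π²H)`,
`a₁ = (8π²hb₀ + 4C_fA_N)/(4π²cψ)`. [cite: SandersVerhulstMurdock2007, Lemma 5.2.7 (linear case)] -/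
theorem termA_le {ξ ν Cf CN AN P₁ Gn rlo rbar hb₀ cψ H M : ℝ}
    (hν : 0 < ν) (hν1 : ν ≤ 1) (hξ : 0 < ξ) (hCf : 0 ≤ Cf) (hCN : 0 ≤ CN) (hAN : CN ≤ AN / ν) (hP₁ : 0 ≤ P₁) (hM : 0 ≤ M)
    (hhb₀ : 0 ≤ hb₀) (hGn : Gn ≤ 4 * Real.pi ^ 2 * ξ ^ 2 * (ν * hb₀) + ξ ^ 2 * Cf * CN + 2 * rlo)
    (hrlo : 0 < rlo) (hcψ : 0 < cψ) (hrlo_ge : 4 * Real.pi ^ 2 * cψ * ξ ^ 2 / ν ≤ rlo)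
    (hH : 0 < H) (hrbar : 8 * Real.pi ^ 2 * H * ξ ^ 2 / ν ≤ rbar) :
    M * (2 * (ξ ^ 2 * Cf * CN)) * P₁ * (1 + (2 * Gn + 2 * (ξ ^ 2 * Cf * CN)) / rlo) ≤
      M * (Cf * AN * (5 + (8 * Real.pi ^ 2 * hb₀ + 4 * Cf * AN) / (4 * Real.pi ^ 2 * cψ)) / (4 * Real.pi ^ 2 * H)) * (rbar * P₁) := by
  have hAN0 : 0 ≤ AN := by
    have := hCN.trans hAN; rwa [le_div_iff₀ hν, zero_mul] at this
  have hπ : 0 < 4 * Real.pi ^ 2 := by positivity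
  -- the ratio
  have hnum : 2 * Gn + 2 * (ξ ^ 2 * Cf * CN) ≤ (8 * Real.pi ^ 2 * ξ ^ 2 * (ν * hb₀) + 4 * (ξ ^ 2 * Cf * (AN / ν))) + 4 * rlo := by
    have h1 : ξ ^ 2 * Cf * CN ≤ ξ ^ 2 * Cf * (AN / ν) := mul_le_mul_of_nonneg_left hAN (by positivity)
    linarith
  have hratio : (2 * Gn + 2 * (ξ ^ 2 * Cf * CN)) / rlo ≤ 4 + (8 * Real.pi ^ 2 * hb₀ + 4 * Cf * AN) / (4 * Real.pi ^ 2 * cψ) := by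
    have hx0 : 0 ≤ 8 * Real.pi ^ 2 * ξ ^ 2 * (ν * hb₀) + 4 * (ξ ^ 2 * Cf * (AN / ν)) := by positivity
    calc (2 * Gn + 2 * (ξ ^ 2 * Cf * CN)) / rlo ≤ ((8 * Real.pi ^ 2 * ξ ^ 2 * (ν * hb₀) + 4 * (ξ ^ 2 * Cf * (AN / ν))) + 4 * rlo) / rlo :=
          div_le_div_of_nonneg_right hnum hrlo.le
      _ = (8 * Real.pi ^ 2 * ξ ^ 2 * (ν * hb₀) + 4 * (ξ ^ 2 * Cf * (AN / ν))) / rlo + 4 := by field_simp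
      _ ≤ (8 * Real.pi ^ 2 * ξ ^ 2 * (ν * hb₀) + 4 * (ξ ^ 2 * Cf * (AN / ν))) / (4 * Real.pi ^ 2 * cψ * ξ ^ 2 / ν) + 4 := by
          gcongr
      _ = (8 * Real.pi ^ 2 * ν ^ 2 * hb₀ + 4 * Cf * AN) / (4 * Real.pi ^ 2 * cψ) + 4 := by
          field_simp
      _ ≤ (8 * Real.pi ^ 2 * hb₀ + 4 * Cf * AN) / (4 * Real.pi ^ 2 * cψ) + 4 := by
          have hν2 : ν ^ 2 ≤ 1 := pow_le_one₀ hν.le hν1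
          have h8 : 0 ≤ 8 * Real.pi ^ 2 * hb₀ := by positivity
          have h5 : 8 * Real.pi ^ 2 * ν ^ 2 * hb₀ ≤ 8 * Real.pi ^ 2 * hb₀ := by nlinarith
          have h6 : (8 * Real.pi ^ 2 * ν ^ 2 * hb₀ + 4 * Cf * AN) / (4 * Real.pi ^ 2 * cψ) ≤
              (8 * Real.pi ^ 2 * hb₀ + 4 * Cf * AN) / (4 * Real.pi ^ 2 * cψ) :=
            div_le_div_of_nonneg_right (by linarith) (by positivity)
          linarith
      _ = _ := by ring
  -- the prefactor against r̄·P₁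
  have hpre : 2 * (ξ ^ 2 * Cf * CN) * P₁ ≤ Cf * AN / (4 * Real.pi ^ 2 * H) * (rbar * P₁) := by
    have h1 : 2 * (ξ ^ 2 * Cf * CN) ≤ 2 * (ξ ^ 2 * Cf * (AN / ν)) := by gcongr
    have h2 : 2 * (ξ ^ 2 * Cf * (AN / ν)) = Cf * AN / (4 * Real.pi ^ 2 * H) * (8 * Real.pi ^ 2 * H * ξ ^ 2 / ν) := by
      field_simp
      ring
    have h3 : Cf * AN / (4 * Real.pi ^ 2 * H) * (8 * Real.pi ^ 2 * H * ξ ^ 2 / ν) ≤ Cf * AN / (4 * Real.pi ^ 2 * H) * rbar :=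
      mul_le_mul_of_nonneg_left hrbar (by positivity)
    calc 2 * (ξ ^ 2 * Cf * CN) * P₁ ≤ Cf * AN / (4 * Real.pi ^ 2 * H) * rbar * P₁ :=
          mul_le_mul_of_nonneg_right (h1.trans (h2.le.trans h3)) hP₁
      _ = _ := by ring
  have hrhs0 : 0 ≤ Cf * AN / (4 * Real.pi ^ 2 * H) * (rbar * P₁) := by
    have : 0 ≤ rbar := le_trans (by positivity) hrbar
    positivity
  by_cases hsgn : 0 ≤ 1 + (2 * Gn + 2 * (ξ ^ 2 * Cf * CN)) / rlo
  · calc M * (2 * (ξ ^ 2 * Cf * CN)) * P₁ * (1 + (2 * Gn + 2 * (ξ ^ 2 * Cf * CN)) / rlo)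
          = M * ((2 * (ξ ^ 2 * Cf * CN) * P₁) * (1 + (2 * Gn + 2 * (ξ ^ 2 * Cf * CN)) / rlo)) := by ring
      _ ≤ M * ((Cf * AN / (4 * Real.pi ^ 2 * H) * (rbar * P₁)) * (5 + (8 * Real.pi ^ 2 * hb₀ + 4 * Cf * AN) / (4 * Real.pi ^ 2 * cψ))) := by
          refine mul_le_mul_of_nonneg_left ?_ hM
          refine mul_le_mul hpre (by linarith [hratio]) hsgn hrhs0
      _ = _ := by ring
  · have hsgn := not_le.1 hsgn
    have hlhs : M * (2 * (ξ ^ 2 * Cf * CN)) * P₁ * (1 + (2 * Gn + 2 * (ξ ^ 2 * Cf * CN)) / rlo) ≤ 0 := by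
      have : 0 ≤ M * (2 * (ξ ^ 2 * Cf * CN)) * P₁ := by positivity
      exact mul_nonpos_of_nonneg_of_nonpos this hsgn.le
    have hrhs : 0 ≤ M * (Cf * AN * (5 + (8 * Real.pi ^ 2 * hb₀ + 4 * Cf * AN) / (4 * Real.pi ^ 2 * cψ)) / (4 * Real.pi ^ 2 * H)) * (rbar * P₁) := by
      have : 0 ≤ rbar := le_trans (by positivity) hrbar
      positivity
    linarith

/-- Term B1 (the initial layer of the forcing, integrated): `ξC_f M·(ξ C_N·min(t, 8/(π²l))) ≤ M·κ_{B1}·(r̄·P₁)`,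
`κ_{B1} = C_f A_N (Λ/lo)/(π⁴ H P₀)` (`P₁ = P₀/ν`). [cite: SandersVerhulstMurdock2007, Lemma 5.2.7 (linear case)] -/
theorem termB1_le {ξ ν Cf CN AN P₁ P0 rbar H M l lo Λ t : ℝ}
    (hν : 0 < ν) (hξ : 0 < ξ) (hCf : 0 ≤ Cf) (hCN : 0 ≤ CN) (hAN : CN ≤ AN / ν) (hM : 0 ≤ M)
    (hl : 0 < l) (hlo : 0 < lo) (hΛ : 0 < Λ) (hwin : ν * (lo / Λ) ≤ l) (ht : 0 ≤ t)
    (hP0 : 0 < P0) (hP₁ : P₁ = P0 / ν) (hH : 0 < H) (hrbar : 8 * Real.pi ^ 2 * H * ξ ^ 2 / ν ≤ rbar) :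
    ξ * Cf * M * (ξ * CN * min t (1 / (Real.pi ^ 2 * l / 8))) ≤ M * (Cf * AN * (Λ / lo) / (Real.pi ^ 4 * H * P0)) * (rbar * P₁) := by
  have hAN0 : 0 ≤ AN := by
    have := hCN.trans hAN; rwa [le_div_iff₀ hν, zero_mul] at this
  have hπ : 0 < Real.pi ^ 2 := by positivity
  have hm0 : 0 ≤ min t (1 / (Real.pi ^ 2 * l / 8)) := le_min ht (by positivity)
  have hm : min t (1 / (Real.pi ^ 2 * l / 8)) ≤ 8 * (Λ / lo / ν) / Real.pi ^ 2 := by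
    calc min t (1 / (Real.pi ^ 2 * l / 8)) ≤ 1 / (Real.pi ^ 2 * l / 8) := min_le_right _ _
      _ = 8 / Real.pi ^ 2 * (1 / l) := by field_simp
      _ ≤ 8 / Real.pi ^ 2 * (Λ / lo / ν) := mul_le_mul_of_nonneg_left (one_div_le_of_window hl hν hlo hΛ hwin) (by positivity)
      _ = _ := by ring
  have h1 : ξ * Cf * M * (ξ * CN * min t (1 / (Real.pi ^ 2 * l / 8))) ≤ ξ * Cf * M * (ξ * (AN / ν) * (8 * (Λ / lo / ν) / Real.pi ^ 2)) := by
    gcongr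
  have h2 : ξ * Cf * M * (ξ * (AN / ν) * (8 * (Λ / lo / ν) / Real.pi ^ 2)) =
      M * (Cf * AN * (Λ / lo) / (Real.pi ^ 4 * H * P0)) * ((8 * Real.pi ^ 2 * H * ξ ^ 2 / ν) * (P0 / ν)) := by
    field_simp
  have h3 : (8 * Real.pi ^ 2 * H * ξ ^ 2 / ν) * (P0 / ν) ≤ rbar * P₁ := by
    rw [hP₁]; exact mul_le_mul_of_nonneg_right hrbar (by positivity)
  calc _ ≤ _ := h1
    _ = _ := h2
    _ ≤ _ := mul_le_mul_of_nonneg_left h3 (by positivity)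

/-- Term B2 (the residual and the projection mismatch of the forcing, integrated): `ξC_f M·((S + 2ξ²C_N)·min(t, 1/r_lo)) ≤
M·κ_{B2}·((ν + ξ')·min(1, r̄t))`, `κ_{B2} = C_f q (s + 2A_N)/(4π²cψ)`. [cite: SandersVerhulstMurdock2007, Lemma 5.2.7 (linear case)] -/
theorem termB2_le {ξ ξ' ν Cf CN AN rlo rbar q cψ S s M t : ℝ}
    (hν : 0 < ν) (hξ : 0 < ξ) (hξν : ξ ≤ ν * ξ') (hξ'1 : ξ' ≤ 1) (hCf : 0 ≤ Cf) (hCN : 0 ≤ CN) (hAN : CN ≤ AN / ν) (hM : 0 ≤ M)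
    (hrlo : 0 < rlo) (hcψ : 0 < cψ) (hrlo_ge : 4 * Real.pi ^ 2 * cψ * ξ ^ 2 / ν ≤ rlo) (hq : 1 ≤ q) (hrq : rlo ≤ q * rbar)
    (ht : 0 ≤ t) (hs : 0 ≤ s) (hS : S ≤ s * ((ν + ξ') * (ξ / ν))) :
    ξ * Cf * M * ((S + 2 * ξ ^ 2 * CN) * min t (1 / rlo)) ≤
      M * (Cf * q * (s + 2 * AN) / (4 * Real.pi ^ 2 * cψ)) * ((ν + ξ') * min 1 (rbar * t)) := by
  have hAN0 : 0 ≤ AN := by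
    have := hCN.trans hAN; rwa [le_div_iff₀ hν, zero_mul] at this
  have hξ'0 : 0 ≤ ξ' := by nlinarith
  have hrbar0 : 0 ≤ rbar := by
    by_contra h
    have : q * rbar < 0 := mul_neg_of_pos_of_neg (by linarith) (not_le.1 h)
    linarith
  have hμ0 : 0 ≤ min 1 (rbar * t) := min_one_mul_nonneg hrbar0 ht
  have hmr : min t (1 / rlo) ≤ q / rlo * min 1 (rbar * t) := min_inv_le ht hrlo hq hrq
  have hmr0 : 0 ≤ min t (1 / rlo) := le_min ht (by positivity)
  have hq_rlo : q / rlo * min 1 (rbar * t) ≤ q / (4 * Real.pi ^ 2 * cψ * ξ ^ 2 / ν) * min 1 (rbar * t) := by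
    gcongr
  have hsum : S + 2 * ξ ^ 2 * CN ≤ s * ((ν + ξ') * (ξ / ν)) + 2 * ξ ^ 2 * (AN / ν) := by
    have := mul_le_mul_of_nonneg_left hAN (by positivity : (0:ℝ) ≤ 2 * ξ ^ 2)
    linarith
  have h1 : ξ * Cf * M * ((S + 2 * ξ ^ 2 * CN) * min t (1 / rlo)) ≤
      ξ * Cf * M * ((s * ((ν + ξ') * (ξ / ν)) + 2 * ξ ^ 2 * (AN / ν)) * (q / (4 * Real.pi ^ 2 * cψ * ξ ^ 2 / ν) * min 1 (rbar * t))) := by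
    have h0 : 0 ≤ ξ * Cf * M := by positivity
    refine mul_le_mul_of_nonneg_left ?_ h0
    exact mul_le_mul hsum (hmr.trans hq_rlo) hmr0 (by positivity)
  have h2 : ξ * Cf * M * ((s * ((ν + ξ') * (ξ / ν)) + 2 * ξ ^ 2 * (AN / ν)) * (q / (4 * Real.pi ^ 2 * cψ * ξ ^ 2 / ν) * min 1 (rbar * t))) =
      M * (Cf * q / (4 * Real.pi ^ 2 * cψ)) * ((s * (ν + ξ') + 2 * AN * ξ) * min 1 (rbar * t)) := by
    field_simp
  have h3 : (s * (ν + ξ') + 2 * AN * ξ) * min 1 (rbar * t) ≤ ((s + 2 * AN) * (ν + ξ')) * min 1 (rbar * t) := by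
    refine mul_le_mul_of_nonneg_right ?_ hμ0
    have hξle : ξ ≤ ν + ξ' := by nlinarith
    nlinarith
  calc _ ≤ _ := h1
    _ = _ := h2
    _ ≤ M * (Cf * q / (4 * Real.pi ^ 2 * cψ)) * (((s + 2 * AN) * (ν + ξ')) * min 1 (rbar * t)) :=
        mul_le_mul_of_nonneg_left h3 (by positivity)
    _ = _ := by ring

/-- The prefactor `1 + L·P₁ ≤ 1 + 2C_fA_NP₀` (`L = 2ξ²C_fC_N`, `P₁ = P₀/ν`, `ξ ≤ ν`). [folklore] -/
theorem bpre_le {ξ ξ' ν Cf CN AN P₁ P0 : ℝ} (hν : 0 < ν) (hξ : 0 < ξ) (hξν : ξ ≤ ν * ξ') (hξ'1 : ξ' ≤ 1)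
    (hCf : 0 ≤ Cf) (hCN : 0 ≤ CN) (hAN : CN ≤ AN / ν) (hP0 : 0 < P0) (hP₁ : P₁ = P0 / ν) :
    1 + 2 * (ξ ^ 2 * Cf * CN) * P₁ ≤ 1 + 2 * Cf * AN * P0 := by
  have hAN0 : 0 ≤ AN := by
    have := hCN.trans hAN; rwa [le_div_iff₀ hν, zero_mul] at this
  have hξν' : ξ ≤ ν := hξν.trans (by nlinarith)
  have h1 : 2 * (ξ ^ 2 * Cf * CN) * P₁ ≤ 2 * (ξ ^ 2 * Cf * (AN / ν)) * (P0 / ν) := by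
    rw [hP₁]; gcongr
  have h2 : 2 * (ξ ^ 2 * Cf * (AN / ν)) * (P0 / ν) = 2 * Cf * AN * P0 * (ξ / ν) ^ 2 := by
    field_simp
  have h3 : (ξ / ν) ^ 2 ≤ 1 := by
    have : ξ / ν ≤ 1 := by rw [div_le_one hν]; exact hξν'
    exact pow_le_one₀ (by positivity) this
  have h4 : 2 * Cf * AN * P0 * (ξ / ν) ^ 2 ≤ 2 * Cf * AN * P0 * 1 := mul_le_mul_of_nonneg_left h3 (by positivity)
  linarith

/-- **THE MASTER RATE IS AT MOST HALF THE CLAUSE BOUND.**  With the atoms and hypotheses of the module docstring and any `C ≥ 1` dominating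
`2(κ_A + b·κ_{B1})` and `2b·κ_{B2}` (`b = 1 + 2C_fA_NP₀`):
`M·L·P₁(1 + (2Gn+L)/r_lo) + (1 + L P₁)·ξC_fM(ξC_N min(t,8/(π²l)) + (S + 2ξ²C_N)min(t,1/r_lo)) ≤ M·(C(C(ν+ξ')min(1,r̄t) + r̄P₁))/2`.
[cite: SandersVerhulstMurdock2007, Theorem 2.8.1 and Lemma 5.2.7 (inhomogeneous linear case)] [cite: MajdaKramer1999, §2.2.1.3 (55)] -/
theorem master_le_half_clause {ξ ξ' ν Cf CN AN P₁ P0 Gn rlo rbar q hb₀ cψ H S s M l lo Λ t C : ℝ}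
    (hν : 0 < ν) (hν1 : ν ≤ 1) (hξ : 0 < ξ) (hξν : ξ ≤ ν * ξ') (hξ'1 : ξ' ≤ 1)
    (hCf : 0 ≤ Cf) (hCN : 0 ≤ CN) (hAN : CN ≤ AN / ν) (hM : 0 ≤ M)
    (hl : 0 < l) (hlo : 0 < lo) (hΛ : 0 < Λ) (hwin : ν * (lo / Λ) ≤ l)
    (hP0 : 0 < P0) (hP₁ : P₁ = P0 / ν) (hhb₀ : 0 ≤ hb₀)
    (hGn : Gn ≤ 4 * Real.pi ^ 2 * ξ ^ 2 * (ν * hb₀) + ξ ^ 2 * Cf * CN + 2 * rlo)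
    (hrlo : 0 < rlo) (hcψ : 0 < cψ) (hrlo_ge : 4 * Real.pi ^ 2 * cψ * ξ ^ 2 / ν ≤ rlo) (hq : 1 ≤ q) (hrq : rlo ≤ q * rbar)
    (hH : 0 < H) (hrbar : 8 * Real.pi ^ 2 * H * ξ ^ 2 / ν ≤ rbar)
    (ht : 0 ≤ t) (hS0 : 0 ≤ S) (hs : 0 ≤ s) (hS : S ≤ s * ((ν + ξ') * (ξ / ν)))
    (hC1 : 1 ≤ C)
    (hCA : 2 * (Cf * AN * (5 + (8 * Real.pi ^ 2 * hb₀ + 4 * Cf * AN) / (4 * Real.pi ^ 2 * cψ)) / (4 * Real.pi ^ 2 * H) +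
      (1 + 2 * Cf * AN * P0) * (Cf * AN * (Λ / lo) / (Real.pi ^ 4 * H * P0))) ≤ C)
    (hCB : 2 * ((1 + 2 * Cf * AN * P0) * (Cf * q * (s + 2 * AN) / (4 * Real.pi ^ 2 * cψ))) ≤ C) :
    M * (2 * (ξ ^ 2 * Cf * CN)) * P₁ * (1 + (2 * Gn + 2 * (ξ ^ 2 * Cf * CN)) / rlo) +
        (1 + 2 * (ξ ^ 2 * Cf * CN) * P₁) *
          (ξ * Cf * M * (ξ * CN * min t (1 / (Real.pi ^ 2 * l / 8)) + (S + 2 * ξ ^ 2 * CN) * min t (1 / rlo))) ≤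
      M * (C * (C * (ν + ξ') * min 1 (rbar * t) + rbar * P₁) / 2) := by
  have hAN0 : 0 ≤ AN := by
    have := hCN.trans hAN; rwa [le_div_iff₀ hν, zero_mul] at this
  have hξ'0 : 0 ≤ ξ' := by nlinarith
  have hP₁0 : 0 ≤ P₁ := by rw [hP₁]; positivity
  have hrbar0 : 0 ≤ rbar := le_trans (by positivity) hrbar
  have hμ0 : 0 ≤ min 1 (rbar * t) := min_one_mul_nonneg hrbar0 ht
  have hA := termA_le hν hν1 hξ hCf hCN hAN hP₁0 hM hhb₀ hGn hrlo hcψ hrlo_ge hH hrbar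
  have hB1 := termB1_le hν hξ hCf hCN hAN hM hl hlo hΛ hwin ht hP0 hP₁ hH hrbar
  have hB2 := termB2_le hν hξ hξν hξ'1 hCf hCN hAN hM hrlo hcψ hrlo_ge hq hrq ht hs hS
  have hb := bpre_le hν hξ hξν hξ'1 hCf hCN hAN hP0 hP₁
  have hb0 : 0 ≤ 1 + 2 * (ξ ^ 2 * Cf * CN) * P₁ := by positivity
  have hB10 : 0 ≤ ξ * Cf * M * (ξ * CN * min t (1 / (Real.pi ^ 2 * l / 8))) := by
    have : 0 ≤ min t (1 / (Real.pi ^ 2 * l / 8)) := le_min ht (by positivity)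
    positivity
  have hB20 : 0 ≤ ξ * Cf * M * ((S + 2 * ξ ^ 2 * CN) * min t (1 / rlo)) := by
    have : 0 ≤ min t (1 / rlo) := le_min ht (by positivity)
    positivity
  -- split the B term
  have hsplit : (1 + 2 * (ξ ^ 2 * Cf * CN) * P₁) *
      (ξ * Cf * M * (ξ * CN * min t (1 / (Real.pi ^ 2 * l / 8)) + (S + 2 * ξ ^ 2 * CN) * min t (1 / rlo))) =
      (1 + 2 * (ξ ^ 2 * Cf * CN) * P₁) *
        (ξ * Cf * M * (ξ * CN * min t (1 / (Real.pi ^ 2 * l / 8))) + ξ * Cf * M * ((S + 2 * ξ ^ 2 * CN) * min t (1 / rlo))) := by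
    ring
  have hB : (1 + 2 * (ξ ^ 2 * Cf * CN) * P₁) *
      (ξ * Cf * M * (ξ * CN * min t (1 / (Real.pi ^ 2 * l / 8))) + ξ * Cf * M * ((S + 2 * ξ ^ 2 * CN) * min t (1 / rlo))) ≤
      (1 + 2 * Cf * AN * P0) *
        (M * (Cf * AN * (Λ / lo) / (Real.pi ^ 4 * H * P0)) * (rbar * P₁) +
          M * (Cf * q * (s + 2 * AN) / (4 * Real.pi ^ 2 * cψ)) * ((ν + ξ') * min 1 (rbar * t))) :=
    mul_le_mul hb (add_le_add hB1 hB2) (add_nonneg hB10 hB20) (by positivity)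
  -- collect
  have hX0 : 0 ≤ rbar * P₁ := by positivity
  have hY0 : 0 ≤ (ν + ξ') * min 1 (rbar * t) := by positivity
  have hcollect : M * (Cf * AN * (5 + (8 * Real.pi ^ 2 * hb₀ + 4 * Cf * AN) / (4 * Real.pi ^ 2 * cψ)) / (4 * Real.pi ^ 2 * H)) * (rbar * P₁) +
      (1 + 2 * Cf * AN * P0) *
        (M * (Cf * AN * (Λ / lo) / (Real.pi ^ 4 * H * P0)) * (rbar * P₁) +
          M * (Cf * q * (s + 2 * AN) / (4 * Real.pi ^ 2 * cψ)) * ((ν + ξ') * min 1 (rbar * t))) =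
      M * ((Cf * AN * (5 + (8 * Real.pi ^ 2 * hb₀ + 4 * Cf * AN) / (4 * Real.pi ^ 2 * cψ)) / (4 * Real.pi ^ 2 * H) +
          (1 + 2 * Cf * AN * P0) * (Cf * AN * (Λ / lo) / (Real.pi ^ 4 * H * P0))) * (rbar * P₁) +
        ((1 + 2 * Cf * AN * P0) * (Cf * q * (s + 2 * AN) / (4 * Real.pi ^ 2 * cψ))) * ((ν + ξ') * min 1 (rbar * t))) := by
    ring
  have hfin : (Cf * AN * (5 + (8 * Real.pi ^ 2 * hb₀ + 4 * Cf * AN) / (4 * Real.pi ^ 2 * cψ)) / (4 * Real.pi ^ 2 * H) +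
          (1 + 2 * Cf * AN * P0) * (Cf * AN * (Λ / lo) / (Real.pi ^ 4 * H * P0))) * (rbar * P₁) +
        ((1 + 2 * Cf * AN * P0) * (Cf * q * (s + 2 * AN) / (4 * Real.pi ^ 2 * cψ))) * ((ν + ξ') * min 1 (rbar * t)) ≤
      C * (C * (ν + ξ') * min 1 (rbar * t) + rbar * P₁) / 2 := by
    have h1 : (Cf * AN * (5 + (8 * Real.pi ^ 2 * hb₀ + 4 * Cf * AN) / (4 * Real.pi ^ 2 * cψ)) / (4 * Real.pi ^ 2 * H) +
          (1 + 2 * Cf * AN * P0) * (Cf * AN * (Λ / lo) / (Real.pi ^ 4 * H * P0))) * (rbar * P₁) ≤ C / 2 * (rbar * P₁) :=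
      mul_le_mul_of_nonneg_right (by linarith only [hCA]) hX0
    have h2 : ((1 + 2 * Cf * AN * P0) * (Cf * q * (s + 2 * AN) / (4 * Real.pi ^ 2 * cψ))) * ((ν + ξ') * min 1 (rbar * t)) ≤
        C / 2 * ((ν + ξ') * min 1 (rbar * t)) := mul_le_mul_of_nonneg_right (by linarith only [hCB]) hY0
    have h3 : C / 2 * ((ν + ξ') * min 1 (rbar * t)) ≤ C * C / 2 * ((ν + ξ') * min 1 (rbar * t)) := by
      refine mul_le_mul_of_nonneg_right ?_ hY0
      have : C ≤ C * C := by nlinarith only [hC1]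
      linarith only [this]
    have e : C * (C * (ν + ξ') * min 1 (rbar * t) + rbar * P₁) / 2 = C / 2 * (rbar * P₁) + C * C / 2 * ((ν + ξ') * min 1 (rbar * t)) := by
      ring
    rw [e]; linarith only [h1, h2, h3]
  calc _ = M * (2 * (ξ ^ 2 * Cf * CN)) * P₁ * (1 + (2 * Gn + 2 * (ξ ^ 2 * Cf * CN)) / rlo) +
        (1 + 2 * (ξ ^ 2 * Cf * CN) * P₁) *
          (ξ * Cf * M * (ξ * CN * min t (1 / (Real.pi ^ 2 * l / 8))) + ξ * Cf * M * ((S + 2 * ξ ^ 2 * CN) * min t (1 / rlo))) := by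
        rw [hsplit]
    _ ≤ _ := add_le_add hA hB
    _ = _ := hcollect
    _ ≤ _ := mul_le_mul_of_nonneg_left hfin hM

/-- **From half the clause bound to the clause**: `X ≤ √E₀·(B/2)` gives `2X² ≤ B²·E₀`. [folklore] -/
theorem two_mul_sq_le_of_le_half {X B E0 : ℝ} (hX0 : 0 ≤ X) (hE0 : 0 ≤ E0) (hX : X ≤ Real.sqrt E0 * (B / 2)) :
    2 * X ^ 2 ≤ B ^ 2 * E0 := by
  have h1 : X ^ 2 ≤ (Real.sqrt E0 * (B / 2)) ^ 2 := pow_le_pow_left₀ hX0 hX 2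
  have h2 : (Real.sqrt E0 * (B / 2)) ^ 2 = E0 * B ^ 2 / 4 := by
    rw [mul_pow, Real.sq_sqrt hE0]; ring
  nlinarith [sq_nonneg B]

/-! ## Clause-window arithmetic (resolution hypothesis `|ℓ|⌈K/ν⌉₊ ≤ n`, smallness) -/

/-- **The smallness hypothesis of the residual sup bound holds on the clause window** once `K ≥ 1 + 96A_N²C_f²Λ²/(π⁴lo²)`:
`2·(12(C_N C_f)²/(π²l))·ξ⁴ ≤ π²l/4` (`C_N ≤ A_N/ν`, `ν lo/Λ ≤ l`, `K·ξ ≤ ν`). [folklore] -/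
theorem hsmall_of_window {ξ ν lo Λ l CN AN Cf K : ℝ} (hν : 0 < ν) (hlo : 0 < lo) (hΛ : 0 < Λ)
    (hwin : ν * (lo / Λ) ≤ l) (hξ : 0 ≤ ξ) (hK : 1 ≤ K) (hξK : K * ξ ≤ ν) (hCN : 0 ≤ CN) (hAN : CN ≤ AN / ν) (hCf : 0 ≤ Cf)
    (hKbig : 96 * AN ^ 2 * Cf ^ 2 * Λ ^ 2 / (Real.pi ^ 4 * lo ^ 2) ≤ K) :
    2 * (12 * (CN * Cf) ^ 2 / (Real.pi ^ 2 * l)) * ξ ^ 4 ≤ Real.pi ^ 2 * l / 4 := by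
  have hAN0 : 0 ≤ AN := by
    have := hCN.trans hAN; rwa [le_div_iff₀ hν, zero_mul] at this
  have hπ : 0 < Real.pi := Real.pi_pos
  have hK0 : 0 < K := by linarith
  have hξν : ξ ≤ ν / K := by rw [le_div_iff₀ hK0]; linarith
  -- monotone substitution
  have h1 : 2 * (12 * (CN * Cf) ^ 2 / (Real.pi ^ 2 * l)) * ξ ^ 4 ≤ 2 * (12 * (AN / ν * Cf) ^ 2 / (Real.pi ^ 2 * (ν * (lo / Λ)))) * (ν / K) ^ 4 := by
    gcongr
  have h2 : 2 * (12 * (AN / ν * Cf) ^ 2 / (Real.pi ^ 2 * (ν * (lo / Λ)))) * (ν / K) ^ 4 =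
      (96 * AN ^ 2 * Cf ^ 2 * Λ ^ 2 / (Real.pi ^ 4 * lo ^ 2)) / K ^ 4 * (Real.pi ^ 2 * (ν * (lo / Λ)) / 4) := by
    field_simp
    ring
  have h3 : (96 * AN ^ 2 * Cf ^ 2 * Λ ^ 2 / (Real.pi ^ 4 * lo ^ 2)) / K ^ 4 ≤ 1 := by
    rw [div_le_one (by positivity)]
    calc 96 * AN ^ 2 * Cf ^ 2 * Λ ^ 2 / (Real.pi ^ 4 * lo ^ 2) ≤ K := hKbig
      _ ≤ K ^ 4 := le_self_pow₀ hK (by norm_num)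
  have h4 : (96 * AN ^ 2 * Cf ^ 2 * Λ ^ 2 / (Real.pi ^ 4 * lo ^ 2)) / K ^ 4 * (Real.pi ^ 2 * (ν * (lo / Λ)) / 4) ≤
      1 * (Real.pi ^ 2 * l / 4) := by
    gcongr
  linarith

/-- `ξ ≤ ν·ξ'` (`ξ = L/n`, `ξ' = L⌈K/ν⌉₊/n`, `K ≥ 1`). [folklore] -/
theorem xi_le_nu_mul_xi' {L K ν : ℝ} {n : ℕ} (hL : 0 ≤ L) (hK : 1 ≤ K) (hν : 0 < ν) (hn : 0 < (n : ℝ)) :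
    L / n ≤ ν * (L * (⌈K / ν⌉₊ : ℝ) / n) := by
  have h1 : 1 ≤ ν * (⌈K / ν⌉₊ : ℝ) := by
    have hc : K / ν ≤ (⌈K / ν⌉₊ : ℝ) := Nat.le_ceil _
    have : ν * (K / ν) = K := by field_simp
    nlinarith [mul_le_mul_of_nonneg_left hc hν.le]
  rw [show ν * (L * (⌈K / ν⌉₊ : ℝ) / n) = (ν * (⌈K / ν⌉₊ : ℝ)) * (L / n) by ring]
  exact le_mul_of_one_le_left (by positivity) h1

/-- `K·ξ ≤ ν` from the resolution hypothesis (`ξ = L/n`, `L⌈K/ν⌉₊ ≤ n`). [folklore] -/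
theorem K_mul_xi_le_nu {L K ν : ℝ} {n : ℕ} (hL : 0 ≤ L) (hK : 0 < K) (hν : 0 < ν) (hn : 0 < (n : ℝ))
    (hres : L * (⌈K / ν⌉₊ : ℝ) ≤ n) : K * (L / n) ≤ ν := by
  have h := xi_le_nu_div_K hL hK hν hn hres
  have := mul_le_mul_of_nonneg_left h hK.le
  rwa [mul_div_cancel₀ _ hK.ne'] at this

/-- `2L < n` from the resolution hypothesis with `K ≥ 3`, `ν ≤ 1`, `L ≥ 1`. [folklore] -/
theorem two_mul_lt_of_res {L K ν : ℝ} {n : ℕ} (hL : 1 ≤ L) (hK : 3 ≤ K) (hν : 0 < ν) (hν1 : ν ≤ 1)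
    (hres : L * (⌈K / ν⌉₊ : ℝ) ≤ n) : 2 * L < n := by
  have hc : K / ν ≤ (⌈K / ν⌉₊ : ℝ) := Nat.le_ceil _
  have h3 : 3 ≤ K / ν := by rw [le_div_iff₀ hν]; nlinarith
  nlinarith

/-- `n ≠ 0` from the resolution hypothesis (`L ≥ 1`, `K > 0`). [folklore] -/
theorem n_ne_zero_of_res {L K ν : ℝ} {n : ℕ} (hL : 1 ≤ L) (hK : 0 < K) (hν : 0 < ν)
    (hres : L * (⌈K / ν⌉₊ : ℝ) ≤ n) : n ≠ 0 := by
  have hc : (1 : ℝ) ≤ (⌈K / ν⌉₊ : ℝ) := by exact_mod_cast Nat.one_le_iff_ne_zero.2 (Nat.ceil_pos.2 (div_pos hK hν)).ne'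
  have h1 : (1 : ℝ) ≤ n := by nlinarith
  intro h
  rw [h] at h1
  norm_num at h1

end Summit.AnomalousDissipation.AnomalousDissipation.Theorems.SolenoidalFractalHomogenisation.LagrangianStep.Sideband

end
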